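import Literature.Probability.Percolation.TriUQuadRealPoint
import Literature.Probability.Percolation.TriUQuadBandProb
import Literature.Probability.Percolation.TriQuadSeparation
import HarnessLib

/-!
# The regions of a tip: locality of its corridor, and disjointness for separated tips

Topic `Literature/Probability/Percolation`; family `crit-perc`, statement **crit-perc.S16**
(`Literature.Probability.Percolation.triTheta_exponent`). Bookkeeping for the "locally monotone
events in disjoint sub-domains" step of Kesten's arm separation in P. Nolin's form (EJP 13 (2008),
§4.3 Lemma 12 [arXiv 0711.4948: Lemma 11]: "`A⁺` and `A⁻` … depend respectively only on the sites
of two disjoint finite sets"), for the U-shaped half-plane region: to a tip `l` of the inner arc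
with foot `f` we attach the **region** `tipRegion s W A A' l f ⊆ I` — the box of reach `A` about
`l` (where the fence frames live) together with a coarse neighbourhood of its corridor
(`corrRegion`). The corridor event `corrOf s W A' l f` is determined by the sites of the region,
is increasing, and has probability bounded below by the band constant; and the regions of two tips
in arc order (`uHt`), the earlier one with the left foot and the later one with the right foot, at
sup-distance more than `M₀ ≥ 2A' + 2W + 2` (`A ≤ A'`), are **disjoint**.

## References

* P. Nolin, Near-critical percolation in two dimensions, *Electron. J. Probab.* 13 (2008), §4.3
  Lemma 12, §4.4 proof of Lemma 15, §4.5 proof of Prop. 17 [arXiv 0711.4948: Lemma 11, Lemma 14,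
  Prop. 16] [Nolin2008].

## Mathlib / tree

Tree: `corrOf` (`TriUQuadRealPoint.lean`), `determinedBy_corr*`, `isUpperSet_corr*`,
`le_real_corr*` (`TriUQuadBandProb.lean`), `uHt`, `uHt_of_top`, `mem_uL_iff` (`TriUQuadArc.lean`,
`TriUQuadFenceSteps.lean`), `TriQuad.InBox` (`TriQuadSeparation.lean`), `boxZ`, `mem_boxZ`,
`uInner`, `mem_uInner`.
-/

noncomputable section

open Set MeasureTheory

namespace Literature.Probability.Percolation

open LatticeModels

/-! ### The regions -/

/-- **Coarse corridor region** of a tip `l` with foot `f` (a union of half-planes and quadrants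
containing the boxes of `corrOf s W A' l f`). [cite: Nolin2008, §4.3 Lemma 12 (arXiv 0711.4948: Lemma 11)] -/
def corrRegion (s W A' : ℕ) (l : Site 2) (f : Bool) : Set (Site 2) :=
  if l 1 = s then
    (if f then {z | (l 0 - A' ≤ z 0 ∧ (s : ℤ) - 2 * W ≤ z 1) ∨ (s : ℤ) - W ≤ z 0}
      else {z | (z 0 ≤ l 0 + A' ∧ (s : ℤ) - 2 * W ≤ z 1) ∨ z 0 ≤ -(s : ℤ) + W})
  else if l 0 = -(s : ℤ) then
    (if f then {z | (z 0 ≤ -(s : ℤ) + W ∧ l 1 - A' ≤ z 1) ∨ (s : ℤ) - 2 * W ≤ z 1 ∨ (s : ℤ) - W ≤ z 0}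
      else {z | z 0 ≤ -(s : ℤ) + W ∧ z 1 ≤ l 1 + A'})
  else
    (if f then {z | (s : ℤ) - W ≤ z 0 ∧ z 1 ≤ l 1 + A'}
      else {z | ((s : ℤ) - W ≤ z 0 ∧ l 1 - A' ≤ z 1) ∨ (s : ℤ) - 2 * W ≤ z 1 ∨ z 0 ≤ -(s : ℤ) + W})

/-- **The region of a tip**: the sites of the inner half-box in the box of reach `A` about the tip
or in the coarse corridor region. [cite: Nolin2008, §4.3 Lemma 12 (arXiv 0711.4948: Lemma 11)] -/
def tipRegion (s W A A' : ℕ) (l : Site 2) (f : Bool) : Set (Site 2) :=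
  uInner s ∩ (boxZ (l 0 - A) (l 0 + A) (l 1 - A) (l 1 + A) ∪ corrRegion s W A' l f)

section Basic

variable {s Nq W A A' : ℕ} {l : Site 2}

/-- The corridor event of a tip is increasing. [folklore] -/
theorem isUpperSet_corrOf (s W A' : ℕ) (l : Site 2) (f : Bool) : IsUpperSet (corrOf s W A' l f) := by
  unfold corrOf
  split_ifs
  · exact isUpperSet_corrTopRight _ _ _
  · exact isUpperSet_corrTopLeft _ _ _
  · exact isUpperSet_corrAroundLeft _ _ _
  · exact isUpperSet_corrLegLeft _ _ _
  · exact isUpperSet_corrLegRight _ _ _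
  · exact isUpperSet_corrAroundRight _ _ _

/-- **Locality of the corridor event**: `corrOf s W A' l f` is determined by the sites of `I` in the
coarse corridor region (`1 ≤ W`, `2W + 1 ≤ s`, `2W ≤ A'`, `A' + W + 1 ≤ s`, `l` on the inner arc). [cite: Nolin2008, §4.3 Lemma 12 (arXiv 0711.4948: Lemma 11)] -/
theorem determinedBy_corrOf (hs : 1 ≤ s) (hsN : s + 1 ≤ Nq) (hW : 1 ≤ W) (hWs : 2 * W + 1 ≤ s)
    (hWA' : 2 * W ≤ A') (hA's : A' + W + 1 ≤ s) (hl : l ∈ uL s Nq) (f : Bool) :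
    DeterminedBy (corrOf s W A' l f) (uInner s ∩ corrRegion s W A' l f) := by
  have hs' : (1 : ℤ) ≤ s := by exact_mod_cast hs
  have hW' : (1 : ℤ) ≤ W := by exact_mod_cast hW
  have hWs' : 2 * (W : ℤ) + 1 ≤ s := by exact_mod_cast hWs
  have hA's' : (A' : ℤ) + W + 1 ≤ s := by exact_mod_cast hA's
  have hWA'' : 2 * (W : ℤ) ≤ A' := by exact_mod_cast hWA'
  have hlL := (mem_uL_iff hs hsN).1 hl
  have pmax : ∀ a b : ℤ, a ≤ max a b ∧ b ≤ max a b ∧ (max a b = a ∨ max a b = b) :=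
    fun a b => ⟨le_max_left a b, le_max_right a b, max_choice a b⟩
  have pmin : ∀ a b : ℤ, min a b ≤ a ∧ min a b ≤ b ∧ (min a b = a ∨ min a b = b) :=
    fun a b => ⟨min_le_left a b, min_le_right a b, min_choice a b⟩
  by_cases htop : l 1 = s
  · obtain ⟨m1, m2, m3⟩ := pmax (-(s : ℤ) + 1) (l 0 - A')
    obtain ⟨n1, n2, n3⟩ := pmin ((s : ℤ) - 1) (l 0 + A')
    cases f
    · simp only [corrOf, corrRegion, htop, if_true, Bool.false_eq_true, if_false]
      refine (determinedBy_corrTopLeft hW hWs (by omega)).mono ?_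
      rintro z (hz | hz) <;> rw [mem_boxZ] at hz <;> refine ⟨by rw [mem_uInner]; omega, ?_⟩ <;>
        simp only [mem_setOf_eq] <;> omega
    · simp only [corrOf, corrRegion, htop, if_true]
      refine (determinedBy_corrTopRight hW hWs (by omega)).mono ?_
      rintro z (hz | hz) <;> rw [mem_boxZ] at hz <;> refine ⟨by rw [mem_uInner]; omega, ?_⟩ <;>
        simp only [mem_setOf_eq] <;> omega
  by_cases hleft : l 0 = -(s : ℤ)
  · obtain ⟨m1, m2, m3⟩ := pmax 0 (l 1 - A')
    obtain ⟨n1, n2, n3⟩ := pmin ((s : ℤ) - W - 1) (l 1 + A')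
    cases f
    · simp only [corrOf, corrRegion, htop, hleft, if_true, Bool.false_eq_true, if_false]
      refine (determinedBy_corrLegLeft hW (by omega)).mono ?_
      intro z hz
      rw [mem_boxZ] at hz
      exact ⟨by rw [mem_uInner]; omega, by simp only [mem_setOf_eq]; omega⟩
    · simp only [corrOf, corrRegion, htop, hleft, if_true, if_false]
      refine (determinedBy_corrAroundLeft hW hWs (by omega)).mono ?_
      rintro z (hz | hz | hz) <;> rw [mem_boxZ] at hz <;> refine ⟨by rw [mem_uInner]; omega, ?_⟩ <;>
        simp only [mem_setOf_eq] <;> omega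
  · have hright : l 0 = s := by omega
    obtain ⟨m1, m2, m3⟩ := pmax 0 (l 1 - A')
    obtain ⟨n1, n2, n3⟩ := pmin ((s : ℤ) - W - 1) (l 1 + A')
    cases f
    · simp only [corrOf, corrRegion, htop, hleft, Bool.false_eq_true, if_false]
      refine (determinedBy_corrAroundRight hW hWs (by omega)).mono ?_
      rintro z (hz | hz | hz) <;> rw [mem_boxZ] at hz <;> refine ⟨by rw [mem_uInner]; omega, ?_⟩ <;>
        simp only [mem_setOf_eq] <;> omega
    · simp only [corrOf, corrRegion, htop, hleft, if_true, if_false]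
      refine (determinedBy_corrLegRight hW (by omega)).mono ?_
      intro z hz
      rw [mem_boxZ] at hz
      exact ⟨by rw [mem_uInner]; omega, by simp only [mem_setOf_eq]; omega⟩

/-- **Probability of the corridor of a tip**: at least the cube of the band constant
(`W = h + 1`, `2s ≤ (j+1) h`, `P_p(LR(2h,h)) ≥ δ₁`, `P_p(LR(h,h)) ≥ δ₂`). [cite: Nolin2008, §4.3 Lemma 12, §4.5 proof of Prop. 17 (arXiv 0711.4948: Lemma 11, Prop. 16)] -/
theorem le_real_corrOf (p : unitInterval) {h j : ℕ} {δ₁ δ₂ : ℝ} (hδ₁ : 0 ≤ δ₁) (hδ₂ : 0 ≤ δ₂)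
    (h₁ : δ₁ ≤ triLRCrossingProb p (2 * h) h) (h₂ : δ₂ ≤ triLRCrossingProb p h h) (hj : 1 ≤ j)
    (hWh : W = h + 1) (hjs : 2 * s ≤ (j + 1) * h) (hWs : 2 * W + 1 ≤ s) (hWA' : 2 * W ≤ A')
    (hA's : A' + 2 * W + 1 ≤ s) (hs : 1 ≤ s) (hsN : s + 1 ≤ Nq) (hl : l ∈ uL s Nq) (f : Bool) :
    (δ₁ ^ j * δ₂ ^ (j - 1)) ^ 3 ≤ (triSitePercolation p).real (corrOf s W A' l f) := by
  have hs' : (1 : ℤ) ≤ s := by exact_mod_cast hs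
  have hW1 : 1 ≤ W := by omega
  have hW' : (1 : ℤ) ≤ W := by exact_mod_cast hW1
  have hWs' : 2 * (W : ℤ) + 1 ≤ s := by exact_mod_cast hWs
  have hA's' : (A' : ℤ) + 2 * W + 1 ≤ s := by exact_mod_cast hA's
  have hWA'' : 2 * (W : ℤ) ≤ A' := by exact_mod_cast hWA'
  have hlL := (mem_uL_iff hs hsN).1 hl
  have pmax : ∀ a b : ℤ, a ≤ max a b ∧ b ≤ max a b ∧ (max a b = a ∨ max a b = b) :=
    fun a b => ⟨le_max_left a b, le_max_right a b, max_choice a b⟩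
  have pmin : ∀ a b : ℤ, min a b ≤ a ∧ min a b ≤ b ∧ (min a b = a ∨ min a b = b) :=
    fun a b => ⟨min_le_left a b, min_le_right a b, min_choice a b⟩
  by_cases htop : l 1 = s
  · obtain ⟨m1, m2, m3⟩ := pmax (-(s : ℤ) + 1) (l 0 - A')
    obtain ⟨n1, n2, n3⟩ := pmin ((s : ℤ) - 1) (l 0 + A')
    cases f
    · simp only [corrOf, htop, if_true, Bool.false_eq_true, if_false]
      exact le_real_corrTopLeft p hδ₁ hδ₂ h₁ h₂ hj hWh hjs hWs (by omega) (by omega)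
    · simp only [corrOf, htop, if_true]
      exact le_real_corrTopRight p hδ₁ hδ₂ h₁ h₂ hj hWh hjs hWs (by omega) (by omega)
  by_cases hleft : l 0 = -(s : ℤ)
  · obtain ⟨m1, m2, m3⟩ := pmax 0 (l 1 - A')
    obtain ⟨n1, n2, n3⟩ := pmin ((s : ℤ) - W - 1) (l 1 + A')
    cases f
    · simp only [corrOf, htop, hleft, if_true, Bool.false_eq_true, if_false]
      exact le_real_corrLegLeft p hδ₁ hδ₂ h₁ h₂ hj hWh hjs (by omega) (by omega)
    · simp only [corrOf, htop, hleft, if_true, if_false]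
      exact le_real_corrAroundLeft p hδ₁ hδ₂ h₁ h₂ hj hWh hjs hWs (by omega) (by omega)
  · obtain ⟨m1, m2, m3⟩ := pmax 0 (l 1 - A')
    obtain ⟨n1, n2, n3⟩ := pmin ((s : ℤ) - W - 1) (l 1 + A')
    cases f
    · simp only [corrOf, htop, hleft, Bool.false_eq_true, if_false]
      exact le_real_corrAroundRight p hδ₁ hδ₂ h₁ h₂ hj hWh hjs hWs (by omega) (by omega)
    · simp only [corrOf, htop, hleft, if_true, if_false]
      exact le_real_corrLegRight p hδ₁ hδ₂ h₁ h₂ hj hWh hjs (by omega) (by omega)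

end Basic

/-! ### Disjointness of the regions of separated tips -/

section Disjoint

variable {s Nq W A A' M₀ : ℕ} {P Q : Site 2}

/-- Arc parameters by side: left `< s`, top in `[s, 3s-1]`, right `≥ 3s`. [folklore] -/
theorem uHt_side (hs : 1 ≤ s) (hsN : s + 1 ≤ Nq) {l : Site 2} (hl : l ∈ uL s Nq) :
    (l 1 = s → uHt s l = 2 * s + l 0) ∧ (l 1 ≠ s → l 0 = -(s : ℤ) → uHt s l = l 1) ∧
      (l 1 ≠ s → l 0 ≠ -(s : ℤ) → l 0 = s ∧ uHt s l = 4 * s - 1 - l 1) := by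
  have hs' : (1 : ℤ) ≤ s := by exact_mod_cast hs
  have hlL := (mem_uL_iff hs hsN).1 hl
  refine ⟨fun h => uHt_of_top h, fun _ h0 => by unfold uHt; rw [if_pos h0], fun h1 h0 => ⟨by omega, ?_⟩⟩
  unfold uHt; rw [if_neg h0, if_neg h1]

set_option maxHeartbeats 1000000 in
/-- **Regions of separated tips are disjoint.** Let `P, Q` be sites of the inner arc with
`uHt P < uHt Q` (arc order) and `Q` outside the `M₀`-box of `P`, where `M₀ ≥ 2A' + 2W + 2`,
`W ≤ A ≤ A'`, `A' + W + 2 ≤ s`. Then the region of `P` with the left foot and the region of `Q`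
with the right foot are disjoint. [cite: Nolin2008, §4.3 Lemma 12 and §4.4 proof of Lemma 15 (η-separated extremities; arXiv 0711.4948: Lemma 11, Lemma 14)] -/
theorem tipRegion_disjoint (hs : 1 ≤ s) (hsN : s + 1 ≤ Nq) (hW : 1 ≤ W) (hWA : W ≤ A) (hAA' : A ≤ A')
    (hM₀ : 2 * A' + 2 * W + 2 ≤ M₀) (hA's : A' + W + 2 ≤ s)
    (hP : P ∈ uL s Nq) (hQ : Q ∈ uL s Nq) (hlt : uHt s P < uHt s Q) (hfar : ¬ TriQuad.InBox P M₀ Q) :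
    Disjoint (tipRegion s W A A' P false) (tipRegion s W A A' Q true) := by
  have hs' : (1 : ℤ) ≤ s := by exact_mod_cast hs
  have hW' : (1 : ℤ) ≤ W := by exact_mod_cast hW
  have hWA' : (W : ℤ) ≤ A := by exact_mod_cast hWA
  have hAA'' : (A : ℤ) ≤ A' := by exact_mod_cast hAA'
  have hM₀' : 2 * (A' : ℤ) + 2 * W + 2 ≤ M₀ := by exact_mod_cast hM₀
  have hA's' : (A' : ℤ) + W + 2 ≤ s := by exact_mod_cast hA's
  have hPL := (mem_uL_iff hs hsN).1 hP
  have hQL := (mem_uL_iff hs hsN).1 hQ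
  have hfar' : Q 0 < P 0 - M₀ ∨ P 0 + M₀ < Q 0 ∨ Q 1 < P 1 - M₀ ∨ P 1 + M₀ < Q 1 := by
    unfold TriQuad.InBox at hfar; omega
  obtain ⟨hPt, hPl, hPr⟩ := uHt_side hs hsN hP
  obtain ⟨hQt, hQl, hQr⟩ := uHt_side hs hsN hQ
  rw [Set.disjoint_left]
  rintro z ⟨hzI, hzP⟩ ⟨-, hzQ⟩
  rw [mem_uInner] at hzI
  -- side analysis: `Q` is not on the left side unless `P` is; `P` is not on the right unless `Q` is
  by_cases hQtop : Q 1 = s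
  · have huQ := hQt hQtop
    have hzQ' : (Q 0 - A ≤ z 0 ∧ z 0 ≤ Q 0 + A ∧ Q 1 - A ≤ z 1 ∧ z 1 ≤ Q 1 + A) ∨
        ((Q 0 - A' ≤ z 0 ∧ (s : ℤ) - 2 * W ≤ z 1) ∨ (s : ℤ) - W ≤ z 0) := by
      simpa only [corrRegion, hQtop, if_true, mem_union, mem_boxZ, mem_setOf_eq] using hzQ
    by_cases hPtop : P 1 = s
    · -- top / top
      have huP := hPt hPtop
      have hzP' : (P 0 - A ≤ z 0 ∧ z 0 ≤ P 0 + A ∧ P 1 - A ≤ z 1 ∧ z 1 ≤ P 1 + A) ∨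
          ((z 0 ≤ P 0 + A' ∧ (s : ℤ) - 2 * W ≤ z 1) ∨ z 0 ≤ -(s : ℤ) + W) := by
        simpa only [corrRegion, hPtop, if_true, Bool.false_eq_true, if_false, mem_union, mem_boxZ,
          mem_setOf_eq] using hzP
      rcases hzP' with hp | hp | hp <;> rcases hzQ' with hq | hq | hq <;> omega
    by_cases hPleft : P 0 = -(s : ℤ)
    · -- left / top
      have hzP' : (P 0 - A ≤ z 0 ∧ z 0 ≤ P 0 + A ∧ P 1 - A ≤ z 1 ∧ z 1 ≤ P 1 + A) ∨
          (z 0 ≤ -(s : ℤ) + W ∧ z 1 ≤ P 1 + A') := by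
        simpa only [corrRegion, hPtop, hPleft, if_true, Bool.false_eq_true, if_false, mem_union,
          mem_boxZ, mem_setOf_eq] using hzP
      rcases hzP' with hp | hp <;> rcases hzQ' with hq | hq | hq <;> omega
    · -- right / top: impossible in arc order
      obtain ⟨hP0, huP⟩ := hPr hPtop hPleft
      omega
  by_cases hQleft : Q 0 = -(s : ℤ)
  · -- `Q` on the left: then `P` is on the left, below
    have huQ := hQl hQtop hQleft
    have hzQ' : (Q 0 - A ≤ z 0 ∧ z 0 ≤ Q 0 + A ∧ Q 1 - A ≤ z 1 ∧ z 1 ≤ Q 1 + A) ∨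
        ((z 0 ≤ -(s : ℤ) + W ∧ Q 1 - A' ≤ z 1) ∨ (s : ℤ) - 2 * W ≤ z 1 ∨ (s : ℤ) - W ≤ z 0) := by
      simpa only [corrRegion, hQtop, hQleft, if_true, if_false, mem_union, mem_boxZ, mem_setOf_eq] using hzQ
    by_cases hPtop : P 1 = s
    · have huP := hPt hPtop; omega
    by_cases hPleft : P 0 = -(s : ℤ)
    · have huP := hPl hPtop hPleft
      have hzP' : (P 0 - A ≤ z 0 ∧ z 0 ≤ P 0 + A ∧ P 1 - A ≤ z 1 ∧ z 1 ≤ P 1 + A) ∨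
          (z 0 ≤ -(s : ℤ) + W ∧ z 1 ≤ P 1 + A') := by
        simpa only [corrRegion, hPtop, hPleft, if_true, Bool.false_eq_true, if_false, mem_union,
          mem_boxZ, mem_setOf_eq] using hzP
      rcases hzP' with hp | hp <;> rcases hzQ' with hq | hq | hq | hq <;> omega
    · obtain ⟨hP0, huP⟩ := hPr hPtop hPleft; omega
  · -- `Q` on the right
    obtain ⟨hQ0, huQ⟩ := hQr hQtop hQleft
    have hzQ' : (Q 0 - A ≤ z 0 ∧ z 0 ≤ Q 0 + A ∧ Q 1 - A ≤ z 1 ∧ z 1 ≤ Q 1 + A) ∨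
        ((s : ℤ) - W ≤ z 0 ∧ z 1 ≤ Q 1 + A') := by
      simpa only [corrRegion, hQtop, hQleft, if_true, if_false, mem_union, mem_boxZ, mem_setOf_eq] using hzQ
    by_cases hPtop : P 1 = s
    · -- top / right
      have huP := hPt hPtop
      have hzP' : (P 0 - A ≤ z 0 ∧ z 0 ≤ P 0 + A ∧ P 1 - A ≤ z 1 ∧ z 1 ≤ P 1 + A) ∨
          ((z 0 ≤ P 0 + A' ∧ (s : ℤ) - 2 * W ≤ z 1) ∨ z 0 ≤ -(s : ℤ) + W) := by
        simpa only [corrRegion, hPtop, if_true, Bool.false_eq_true, if_false, mem_union, mem_boxZ,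
          mem_setOf_eq] using hzP
      rcases hzP' with hp | hp | hp <;> rcases hzQ' with hq | hq <;> omega
    by_cases hPleft : P 0 = -(s : ℤ)
    · -- left / right
      have hzP' : (P 0 - A ≤ z 0 ∧ z 0 ≤ P 0 + A ∧ P 1 - A ≤ z 1 ∧ z 1 ≤ P 1 + A) ∨
          (z 0 ≤ -(s : ℤ) + W ∧ z 1 ≤ P 1 + A') := by
        simpa only [corrRegion, hPtop, hPleft, if_true, Bool.false_eq_true, if_false, mem_union,
          mem_boxZ, mem_setOf_eq] using hzP
      rcases hzP' with hp | hp <;> rcases hzQ' with hq | hq <;> omega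
    · -- right / right
      obtain ⟨hP0, huP⟩ := hPr hPtop hPleft
      have hzP' : (P 0 - A ≤ z 0 ∧ z 0 ≤ P 0 + A ∧ P 1 - A ≤ z 1 ∧ z 1 ≤ P 1 + A) ∨
          (((s : ℤ) - W ≤ z 0 ∧ P 1 - A' ≤ z 1) ∨ (s : ℤ) - 2 * W ≤ z 1 ∨ z 0 ≤ -(s : ℤ) + W) := by
        simpa only [corrRegion, hPtop, hPleft, Bool.false_eq_true, if_false, mem_union, mem_boxZ,
          mem_setOf_eq] using hzP
      rcases hzP' with hp | hp | hp | hp <;> rcases hzQ' with hq | hq <;> omega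

end Disjoint

end Literature.Probability.Percolation
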